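import Summits.FinalStateConjecture.FinalStateConjecture.Theses.ClusterCompleteness
import Literature.Geometry.Lorentzian.CoordCurvature

/-!
# Line `split` for crux `ClusterCompleteness.OmegaLimitMultiKerr` (stmt-FinalStateConjecture-17639) —
# the BC2-redirect decomposition, end to end: 6 stubs → the two children → the crux BY NAME

Crux-strategist planner-cstrat-stmt-FinalStateConjecture-17639-r1-0, 2026-08-17. This file is the UNION of the two
child skeletons `Lines/split_child1_birth.lean` (child 1 `GenericTameNonExtremalEra`: stubs
`stub_genericTameEraRedShift` [generic], `stub_redShiftExcludesExtremalRecurrence` [pointwise]) and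
`Lines/split_child2_birth.lean` (child 2 `TameEraRecurs`: stubs `stub_eraHorizonNull`,
`stub_asymptoticallyStationaryEra`, `stub_noHairUpToGauge`, `stub_rebase`, all pointwise), followed by the
PROVED assembly `omegaLimitMultiKerr_of_subs` (child 1 → child 2 → crux; monotonicity of tame genericity,
closed → sub-extremal labels by child 1 (ii), order descent k+2 → k). `OmegaLimitMultiKerr_of` concludes the
route decl BY NAME from the six stub signatures; the only sorries are the six `stub_*`.
See `Lines/split_child{1,2}_birth.md` (cards) and the strategist's DECOMPOSITION.md (evidence on the item).
Not registered with `ledger skeleton check` by the strategist (the parent's registration belongs to the live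
lead of line `birth`); a continuation lead may register it at a cycle boundary.
-/

set_option linter.dupNamespace false

noncomputable section

open scoped Manifold ContDiff Topology ENNReal
open Set Filter Function TopologicalSpace

namespace Summit.FinalStateConjecture.FinalStateConjecture.Cruxes.OmegaLimitMultiKerr.Split

open Literature.Geometry.Lorentzian

open Summit.FinalStateConjecture.FinalStateConjecture.Theses.ClusterCompleteness (OmegaLimitMultiKerr)

/-! ### The two children (verbatim the statements filed for the split) -/

def Sig.GenericTameNonExtremalEra : Prop :=
  open Literature.Geometry.Lorentzian in open scoped ContDiff in ∀ (k : ℕ) (X : Type) [TopologicalSpace X] [ChartedSpace E3 X] [IsManifold (𝓡 3) ∞ X] [T2Space X] [SecondCountableTopology X] [ConnectedSpace X], InitialDataSet.IsTameChristodoulouGeneric (admissibleVacuumData X) (fun D ↦ (∃ 𝒟 : VacuumCauchyDevelopment D, 𝒟.IsMaximal) ∧ ∀ 𝒟 : VacuumCauchyDevelopment D, 𝒟.IsMaximal → ¬ (Summit.FinalStateConjecture.HasCompleteNullInfinity 𝒟.toCauchyDevelopment ∧ ∃ (O : Set 𝒟.carrier) (d : FinalStateDecomposition 𝒟.toSpacetime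 O 2), (∀ i, Kerr.IsSubextremal (d.mass i) (d.spin i)) ∧ O = Summit.FinalStateConjecture.exteriorOf 𝒟.toCauchyDevelopment d.charted ∧ Summit.FinalStateConjecture.RaysStayInClosure 𝒟.toCauchyDevelopment O ∧ Summit.FinalStateConjecture.HasExhaustiveCharts d ∧ Summit.FinalStateConjecture.IsFutureOriented d) → (∃ (O : Set 𝒟.carrier) (N : ℕ) (M a : Fin N → ℝ) (mo : Fin N → lorentzGroup × E4) (τ₀ : ℝ) (Ψ : ∀ i, boostedKerrExterior (mo i).1 (mo i).2 (M i) (a i) → 𝒟.carrier) (ρ R : Fin N → ℝ → ℝ) (U₀ : Opens E4) (Ψ₀ : U₀ → 𝒟.carrier), (∀ i, 0 < M i ∧ |a i| ≤ M i) ∧ (∀ i, 𝒟.toSpacetime.IsLateChart (boostedKerrBackground (mo i).1 (mo i).2 (M i) (a i)) O τ₀ (Ψ i)) ∧ 𝒟.toSpacetime.IsLateChart (Minkowski.backgroundOn U₀) O τ₀ Ψ₀ ∧ (∀ i, Tendsto (fun t ↦ ρ i t / t) atTop (𝓝 0)) ∧ (∀ i, Tendsto (R i) atTop atTop ∧ ∀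 τ, max (Kerr.rPlus (M i) (a i)) 0 + 1 ≤ R i τ) ∧ {x : E4 | τ₀ < x 0 ∧ ∀ i, ρ i (x 0) < Kerr.radius (a i) (poincareInv (mo i).1 (mo i).2 x)} ⊆ (U₀ : Set E4) ∧ (∀ R' : ℝ, ∃ τ₁ : ℝ, Pairwise (Function.onFun Disjoint fun i ↦ Ψ i '' (boostedKerrBackground (mo i).1 (mo i).2 (M i) (a i)).truncLateRegion τ₁ R')) ∧ O = Summit.FinalStateConjecture.exteriorOf 𝒟.toCauchyDevelopment ((⋃ i, Ψ i '' (boostedKerrBackground (mo i).1 (mo i).2 (M i) (a i)).lateRegion τ₀) ∪ Ψ₀ '' (Minkowski.backgroundOn U₀).lateRegion τ₀) ∧ Summit.FinalStateConjecture.RaysStayInClosure 𝒟.toCauchyDevelopment O ∧ (∀ τ₁ : ℝ, τ₀ < τ₁ → O \ (Ψ₀ '' (Minkowski.backgroundOn U₀).lateRegion τ₁ ∪ ⋃ i, Ψ i '' {x | τ₁ < (boostedKerrBackground (mo i).1 (mo i).2 (M i) (a i)).time x.1 ∧ (boostedKerrBackground (mo i).1 (mo i).2 (M i) (a i)).radius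 x.1 ≤ R i ((boostedKerrBackground (mo i).1 (mo i).2 (M i) (a i)).time x.1)}) ⊆ 𝒟.metric.causalPast 𝒟.timeOrientation (Ψ₀ '' (Minkowski.backgroundOn U₀).timeSlab τ₁ ∪ ⋃ i, Ψ i '' (boostedKerrBackground (mo i).1 (mo i).2 (M i) (a i)).truncTimeSlab (R i τ₁) τ₁)) ∧ ((∀ i, Summit.FinalStateConjecture.IsOrthochronous (mo i).1) ∧ ∀ τ : ℝ, τ₀ < τ → ∀ x ∈ (Minkowski.backgroundOn U₀).timeSlab τ, 𝒟.toSpacetime.timeOrientation.IsFutureDirected (mfderiv 𝓘(ℝ, E4) (𝓡 4) Ψ₀ x (E4.basisVector 0))) ∧ (∀ τ : ℝ, τ₀ < τ → 𝒟.toSpacetime.deviationCk (Minkowski.backgroundOn U₀) Ψ₀ 0 τ ≤ ENNReal.ofReal (1 / 8) ∧ ∀ i, 𝒟.toSpacetime.truncDeviationCk (boostedKerrBackground (mo i).1 (mo i).2 (M i) (a i)) (Ψ i) 0 (R i τ) τ ≤ ENNReal.ofReal (1 / 8)) ∧ (∃ B : NNReal, ∀ τ : ℝ, τ₀ < τ →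 𝒟.toSpacetime.deviationCk (Minkowski.backgroundOn U₀) Ψ₀ (k + 4) τ ≤ (B : ENNReal)) ∧ (∀ R' : ℝ, ∃ B : NNReal, ∀ τ : ℝ, τ₀ < τ → ∀ i, 𝒟.toSpacetime.truncDeviationCk (boostedKerrBackground (mo i).1 (mo i).2 (M i) (a i)) (Ψ i) (k + 4) R' τ ≤ (B : ENNReal)) ∧ (∀ ε : ℝ, 0 < ε → ∃ Rf : ℝ, ∀ τ : ℝ, τ₀ < τ → supCkENorm (Subtype.val '' {x | x ∈ (Minkowski.backgroundOn U₀).timeSlab τ ∧ Rf ≤ ‖E4.spatial (x : E4)‖}) (k + 4) (𝒟.toSpacetime.deviationExtend (Minkowski.backgroundOn U₀) Ψ₀) ≤ ENNReal.ofReal ε)) ∧ ∀ (O : Set 𝒟.carrier) (N : ℕ) (M a : Fin N → ℝ) (mo : Fin N → lorentzGroup × E4) (τ₀ : ℝ) (Ψ : ∀ i, boostedKerrExterior (mo i).1 (mo i).2 (M i) (a i) → 𝒟.carrier) (ρ R : Fin N → ℝ → ℝ) (U₀ : Opens E4) (Ψ₀ : U₀ → 𝒟.carrier), (∀ i, 0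 < M i ∧ |a i| ≤ M i) ∧ (∀ i, 𝒟.toSpacetime.IsLateChart (boostedKerrBackground (mo i).1 (mo i).2 (M i) (a i)) O τ₀ (Ψ i)) ∧ 𝒟.toSpacetime.IsLateChart (Minkowski.backgroundOn U₀) O τ₀ Ψ₀ ∧ (∀ i, Tendsto (fun t ↦ ρ i t / t) atTop (𝓝 0)) ∧ (∀ i, Tendsto (R i) atTop atTop ∧ ∀ τ, max (Kerr.rPlus (M i) (a i)) 0 + 1 ≤ R i τ) ∧ {x : E4 | τ₀ < x 0 ∧ ∀ i, ρ i (x 0) < Kerr.radius (a i) (poincareInv (mo i).1 (mo i).2 x)} ⊆ (U₀ : Set E4) ∧ (∀ R' : ℝ, ∃ τ₁ : ℝ, Pairwise (Function.onFun Disjoint fun i ↦ Ψ i '' (boostedKerrBackground (mo i).1 (mo i).2 (M i) (a i)).truncLateRegion τ₁ R')) ∧ O = Summit.FinalStateConjecture.exteriorOf 𝒟.toCauchyDevelopment ((⋃ i, Ψ i '' (boostedKerrBackground (mo i).1 (mo i).2 (M i) (a i)).lateRegion τ₀) ∪ Ψ₀ '' (Minkowski.backgroundOn U₀).lateRegion τ₀)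 ∧ Summit.FinalStateConjecture.RaysStayInClosure 𝒟.toCauchyDevelopment O ∧ (∀ τ₁ : ℝ, τ₀ < τ₁ → O \ (Ψ₀ '' (Minkowski.backgroundOn U₀).lateRegion τ₁ ∪ ⋃ i, Ψ i '' {x | τ₁ < (boostedKerrBackground (mo i).1 (mo i).2 (M i) (a i)).time x.1 ∧ (boostedKerrBackground (mo i).1 (mo i).2 (M i) (a i)).radius x.1 ≤ R i ((boostedKerrBackground (mo i).1 (mo i).2 (M i) (a i)).time x.1)}) ⊆ 𝒟.metric.causalPast 𝒟.timeOrientation (Ψ₀ '' (Minkowski.backgroundOn U₀).timeSlab τ₁ ∪ ⋃ i, Ψ i '' (boostedKerrBackground (mo i).1 (mo i).2 (M i) (a i)).truncTimeSlab (R i τ₁) τ₁)) ∧ ((∀ i, Summit.FinalStateConjecture.IsOrthochronous (mo i).1) ∧ ∀ τ : ℝ, τ₀ < τ → ∀ x ∈ (Minkowski.backgroundOn U₀).timeSlab τ, 𝒟.toSpacetime.timeOrientation.IsFutureDirected (mfderiv 𝓘(ℝ, E4) (𝓡 4) Ψ₀ x (E4.basisVector 0))) ∧ (∀ τ : ℝ,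 τ₀ < τ → 𝒟.toSpacetime.deviationCk (Minkowski.backgroundOn U₀) Ψ₀ 0 τ ≤ ENNReal.ofReal (1 / 4) ∧ ∀ i, 𝒟.toSpacetime.truncDeviationCk (boostedKerrBackground (mo i).1 (mo i).2 (M i) (a i)) (Ψ i) 0 (R i τ) τ ≤ ENNReal.ofReal (1 / 4)) ∧ (∀ R' : ℝ, ∀ ε : ℝ, 0 < ε → ∃ᶠ τ in atTop, 𝒟.toSpacetime.deviationCk (Minkowski.backgroundOn U₀) Ψ₀ (k + 2) τ ≤ ENNReal.ofReal ε ∧ ∀ i, 𝒟.toSpacetime.truncDeviationCk (boostedKerrBackground (mo i).1 (mo i).2 (M i) (a i)) (Ψ i) (k + 2) R' τ ≤ ENNReal.ofReal ε ∧ ∀ x ∈ (boostedKerrBackground (mo i).1 (mo i).2 (M i) (a i)).truncTimeSlab R' τ, 𝒟.toSpacetime.timeOrientation.IsFutureDirected (mfderiv 𝓘(ℝ, E4) (𝓡 4) (Ψ i) x (((mo i).1 : E4 ≃L[ℝ] E4) (Kerr.timeVector (M i) (a i) (poincareInv (mo i).1 (mo i).2 (x : E4)))))) → ∀ i, Kerr.IsSubextremal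 (M i) (a i)) 1

def Sig.TameEraRecurs : Prop :=
  open Literature.Geometry.Lorentzian in open scoped ContDiff in ∀ (k : ℕ) (X : Type) [TopologicalSpace X] [ChartedSpace E3 X] [IsManifold (𝓡 3) ∞ X] [T2Space X] [SecondCountableTopology X] [ConnectedSpace X], ∀ D ∈ admissibleVacuumData X, ∀ 𝒟 : VacuumCauchyDevelopment D, 𝒟.IsMaximal → (∃ (O : Set 𝒟.carrier) (N : ℕ) (M a : Fin N → ℝ) (mo : Fin N → lorentzGroup × E4) (τ₀ : ℝ) (Ψ : ∀ i, boostedKerrExterior (mo i).1 (mo i).2 (M i) (a i) → 𝒟.carrier) (ρ R : Fin N → ℝ → ℝ) (U₀ : Opens E4) (Ψ₀ : U₀ → 𝒟.carrier), (∀ i, 0 < M i ∧ |a i| ≤ M i) ∧ (∀ i, 𝒟.toSpacetime.IsLateChart (boostedKerrBackground (mo i).1 (mo i).2 (M i) (a i)) O τ₀ (Ψ i)) ∧ 𝒟.toSpacetime.IsLateChart (Minkowski.backgroundOn U₀) O τ₀ Ψ₀ ∧ (∀ i, Tendsto (fun t ↦ ρ i t / t) atTop (𝓝 0)) ∧ (∀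 i, Tendsto (R i) atTop atTop ∧ ∀ τ, max (Kerr.rPlus (M i) (a i)) 0 + 1 ≤ R i τ) ∧ {x : E4 | τ₀ < x 0 ∧ ∀ i, ρ i (x 0) < Kerr.radius (a i) (poincareInv (mo i).1 (mo i).2 x)} ⊆ (U₀ : Set E4) ∧ (∀ R' : ℝ, ∃ τ₁ : ℝ, Pairwise (Function.onFun Disjoint fun i ↦ Ψ i '' (boostedKerrBackground (mo i).1 (mo i).2 (M i) (a i)).truncLateRegion τ₁ R')) ∧ O = Summit.FinalStateConjecture.exteriorOf 𝒟.toCauchyDevelopment ((⋃ i, Ψ i '' (boostedKerrBackground (mo i).1 (mo i).2 (M i) (a i)).lateRegion τ₀) ∪ Ψ₀ '' (Minkowski.backgroundOn U₀).lateRegion τ₀) ∧ Summit.FinalStateConjecture.RaysStayInClosure 𝒟.toCauchyDevelopment O ∧ (∀ τ₁ : ℝ, τ₀ < τ₁ → O \ (Ψ₀ '' (Minkowski.backgroundOn U₀).lateRegion τ₁ ∪ ⋃ i, Ψ i '' {x | τ₁ < (boostedKerrBackground (mo i).1 (mo i).2 (M i) (a i)).time x.1 ∧ (boostedKerrBackground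 (mo i).1 (mo i).2 (M i) (a i)).radius x.1 ≤ R i ((boostedKerrBackground (mo i).1 (mo i).2 (M i) (a i)).time x.1)}) ⊆ 𝒟.metric.causalPast 𝒟.timeOrientation (Ψ₀ '' (Minkowski.backgroundOn U₀).timeSlab τ₁ ∪ ⋃ i, Ψ i '' (boostedKerrBackground (mo i).1 (mo i).2 (M i) (a i)).truncTimeSlab (R i τ₁) τ₁)) ∧ ((∀ i, Summit.FinalStateConjecture.IsOrthochronous (mo i).1) ∧ ∀ τ : ℝ, τ₀ < τ → ∀ x ∈ (Minkowski.backgroundOn U₀).timeSlab τ, 𝒟.toSpacetime.timeOrientation.IsFutureDirected (mfderiv 𝓘(ℝ, E4) (𝓡 4) Ψ₀ x (E4.basisVector 0))) ∧ (∀ τ : ℝ, τ₀ < τ → 𝒟.toSpacetime.deviationCk (Minkowski.backgroundOn U₀) Ψ₀ 0 τ ≤ ENNReal.ofReal (1 / 8) ∧ ∀ i, 𝒟.toSpacetime.truncDeviationCk (boostedKerrBackground (mo i).1 (mo i).2 (M i) (a i)) (Ψ i) 0 (R i τ) τ ≤ ENNReal.ofReal (1 / 8)) ∧ (∃ B : NNReal,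 ∀ τ : ℝ, τ₀ < τ → 𝒟.toSpacetime.deviationCk (Minkowski.backgroundOn U₀) Ψ₀ (k + 4) τ ≤ (B : ENNReal)) ∧ (∀ R' : ℝ, ∃ B : NNReal, ∀ τ : ℝ, τ₀ < τ → ∀ i, 𝒟.toSpacetime.truncDeviationCk (boostedKerrBackground (mo i).1 (mo i).2 (M i) (a i)) (Ψ i) (k + 4) R' τ ≤ (B : ENNReal)) ∧ (∀ ε : ℝ, 0 < ε → ∃ Rf : ℝ, ∀ τ : ℝ, τ₀ < τ → supCkENorm (Subtype.val '' {x | x ∈ (Minkowski.backgroundOn U₀).timeSlab τ ∧ Rf ≤ ‖E4.spatial (x : E4)‖}) (k + 4) (𝒟.toSpacetime.deviationExtend (Minkowski.backgroundOn U₀) Ψ₀) ≤ ENNReal.ofReal ε)) → ¬ (Summit.FinalStateConjecture.HasCompleteNullInfinity 𝒟.toCauchyDevelopment ∧ ∃ (O : Set 𝒟.carrier) (d : FinalStateDecomposition 𝒟.toSpacetime O 2), (∀ i, Kerr.IsSubextremal (d.mass i) (d.spin i)) ∧ O = Summit.FinalStateConjecture.exteriorOf 𝒟.toCauchyDevelopment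 d.charted ∧ Summit.FinalStateConjecture.RaysStayInClosure 𝒟.toCauchyDevelopment O ∧ Summit.FinalStateConjecture.HasExhaustiveCharts d ∧ Summit.FinalStateConjecture.IsFutureOriented d) → ∃ (O : Set 𝒟.carrier) (N : ℕ) (M a : Fin N → ℝ) (mo : Fin N → lorentzGroup × E4) (τ₀ : ℝ) (Ψ : ∀ i, boostedKerrExterior (mo i).1 (mo i).2 (M i) (a i) → 𝒟.carrier) (ρ R : Fin N → ℝ → ℝ) (U₀ : Opens E4) (Ψ₀ : U₀ → 𝒟.carrier), (∀ i, 0 < M i ∧ |a i| ≤ M i) ∧ (∀ i, 𝒟.toSpacetime.IsLateChart (boostedKerrBackground (mo i).1 (mo i).2 (M i) (a i)) O τ₀ (Ψ i)) ∧ 𝒟.toSpacetime.IsLateChart (Minkowski.backgroundOn U₀) O τ₀ Ψ₀ ∧ (∀ i, Tendsto (fun t ↦ ρ i t / t) atTop (𝓝 0)) ∧ (∀ i, Tendsto (R i) atTop atTop ∧ ∀ τ, max (Kerr.rPlus (M i) (a i)) 0 + 1 ≤ R i τ) ∧ {x : E4 | τ₀ < x 0 ∧ ∀ i, ρ i (x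 0) < Kerr.radius (a i) (poincareInv (mo i).1 (mo i).2 x)} ⊆ (U₀ : Set E4) ∧ (∀ R' : ℝ, ∃ τ₁ : ℝ, Pairwise (Function.onFun Disjoint fun i ↦ Ψ i '' (boostedKerrBackground (mo i).1 (mo i).2 (M i) (a i)).truncLateRegion τ₁ R')) ∧ O = Summit.FinalStateConjecture.exteriorOf 𝒟.toCauchyDevelopment ((⋃ i, Ψ i '' (boostedKerrBackground (mo i).1 (mo i).2 (M i) (a i)).lateRegion τ₀) ∪ Ψ₀ '' (Minkowski.backgroundOn U₀).lateRegion τ₀) ∧ Summit.FinalStateConjecture.RaysStayInClosure 𝒟.toCauchyDevelopment O ∧ (∀ τ₁ : ℝ, τ₀ < τ₁ → O \ (Ψ₀ '' (Minkowski.backgroundOn U₀).lateRegion τ₁ ∪ ⋃ i, Ψ i '' {x | τ₁ < (boostedKerrBackground (mo i).1 (mo i).2 (M i) (a i)).time x.1 ∧ (boostedKerrBackground (mo i).1 (mo i).2 (M i) (a i)).radius x.1 ≤ R i ((boostedKerrBackground (mo i).1 (mo i).2 (M i) (a i)).time x.1)}) ⊆ 𝒟.metric.causalPast 𝒟.timeOrientation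 (Ψ₀ '' (Minkowski.backgroundOn U₀).timeSlab τ₁ ∪ ⋃ i, Ψ i '' (boostedKerrBackground (mo i).1 (mo i).2 (M i) (a i)).truncTimeSlab (R i τ₁) τ₁)) ∧ ((∀ i, Summit.FinalStateConjecture.IsOrthochronous (mo i).1) ∧ ∀ τ : ℝ, τ₀ < τ → ∀ x ∈ (Minkowski.backgroundOn U₀).timeSlab τ, 𝒟.toSpacetime.timeOrientation.IsFutureDirected (mfderiv 𝓘(ℝ, E4) (𝓡 4) Ψ₀ x (E4.basisVector 0))) ∧ (∀ τ : ℝ, τ₀ < τ → 𝒟.toSpacetime.deviationCk (Minkowski.backgroundOn U₀) Ψ₀ 0 τ ≤ ENNReal.ofReal (1 / 4) ∧ ∀ i, 𝒟.toSpacetime.truncDeviationCk (boostedKerrBackground (mo i).1 (mo i).2 (M i) (a i)) (Ψ i) 0 (R i τ) τ ≤ ENNReal.ofReal (1 / 4)) ∧ ∀ R' : ℝ, ∀ ε : ℝ, 0 < ε → ∃ᶠ τ in atTop, 𝒟.toSpacetime.deviationCk (Minkowski.backgroundOn U₀) Ψ₀ (k + 2) τ ≤ ENNReal.ofReal ε ∧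 ∀ i, 𝒟.toSpacetime.truncDeviationCk (boostedKerrBackground (mo i).1 (mo i).2 (M i) (a i)) (Ψ i) (k + 2) R' τ ≤ ENNReal.ofReal ε ∧ ∀ x ∈ (boostedKerrBackground (mo i).1 (mo i).2 (M i) (a i)).truncTimeSlab R' τ, 𝒟.toSpacetime.timeOrientation.IsFutureDirected (mfderiv 𝓘(ℝ, E4) (𝓡 4) (Ψ i) x (((mo i).1 : E4 ≃L[ℝ] E4) (Kerr.timeVector (M i) (a i) (poincareInv (mo i).1 (mo i).2 (x : E4)))))

/-! ### Stub signatures -/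

def Sig.stub_genericTameEraRedShift : Prop :=
  ∀ (k : ℕ) (X : Type) [TopologicalSpace X] [ChartedSpace E3 X] [IsManifold (𝓡 3) ∞ X] [T2Space X] [SecondCountableTopology X] [ConnectedSpace X], InitialDataSet.IsTameChristodoulouGeneric (admissibleVacuumData X) (fun D ↦ (∃ 𝒟 : VacuumCauchyDevelopment D, 𝒟.IsMaximal) ∧ ∀ 𝒟 : VacuumCauchyDevelopment D, 𝒟.IsMaximal → ¬ (Summit.FinalStateConjecture.HasCompleteNullInfinity 𝒟.toCauchyDevelopment ∧ ∃ (O : Set 𝒟.carrier) (d : FinalStateDecomposition 𝒟.toSpacetime O 2), (∀ i, Kerr.IsSubextremal (d.mass i) (d.spin i)) ∧ O = Summit.FinalStateConjecture.exteriorOf 𝒟.toCauchyDevelopment d.charted ∧ Summit.FinalStateConjecture.RaysStayInClosure 𝒟.toCauchyDevelopment O ∧ Summit.FinalStateConjecture.HasExhaustiveCharts d ∧ Summit.FinalStateConjecture.IsFutureOriented d) → ∃ (O : Set 𝒟.carrier) (N : ℕ) (M a : Fin N → ℝ) (mo : Fin N → lorentzGroup × E4) (τ₀ : ℝ) (Ψ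 : ∀ i, boostedKerrExterior (mo i).1 (mo i).2 (M i) (a i) → 𝒟.carrier) (ρ R : Fin N → ℝ → ℝ) (U₀ : Opens E4) (Ψ₀ : U₀ → 𝒟.carrier), ((∀ i, 0 < M i ∧ |a i| ≤ M i) ∧ (∀ i, 𝒟.toSpacetime.IsLateChart (boostedKerrBackground (mo i).1 (mo i).2 (M i) (a i)) O τ₀ (Ψ i)) ∧ 𝒟.toSpacetime.IsLateChart (Minkowski.backgroundOn U₀) O τ₀ Ψ₀ ∧ (∀ i, Tendsto (fun t ↦ ρ i t / t) atTop (𝓝 0)) ∧ (∀ i, Tendsto (R i) atTop atTop ∧ ∀ τ, max (Kerr.rPlus (M i) (a i)) 0 + 1 ≤ R i τ) ∧ {x : E4 | τ₀ < x 0 ∧ ∀ i, ρ i (x 0) < Kerr.radius (a i) (poincareInv (mo i).1 (mo i).2 x)} ⊆ (U₀ : Set E4) ∧ (∀ R' : ℝ, ∃ τ₁ : ℝ, Pairwise (Function.onFun Disjoint fun i ↦ Ψ i '' (boostedKerrBackground (mo i).1 (mo i).2 (M i) (a i)).truncLateRegion τ₁ R')) ∧ O = Summit.FinalStateConjecture.exteriorOf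 𝒟.toCauchyDevelopment ((⋃ i, Ψ i '' (boostedKerrBackground (mo i).1 (mo i).2 (M i) (a i)).lateRegion τ₀) ∪ Ψ₀ '' (Minkowski.backgroundOn U₀).lateRegion τ₀) ∧ Summit.FinalStateConjecture.RaysStayInClosure 𝒟.toCauchyDevelopment O ∧ (∀ τ₁ : ℝ, τ₀ < τ₁ → O \ (Ψ₀ '' (Minkowski.backgroundOn U₀).lateRegion τ₁ ∪ ⋃ i, Ψ i '' {x | τ₁ < (boostedKerrBackground (mo i).1 (mo i).2 (M i) (a i)).time x.1 ∧ (boostedKerrBackground (mo i).1 (mo i).2 (M i) (a i)).radius x.1 ≤ R i ((boostedKerrBackground (mo i).1 (mo i).2 (M i) (a i)).time x.1)}) ⊆ 𝒟.metric.causalPast 𝒟.timeOrientation (Ψ₀ '' (Minkowski.backgroundOn U₀).timeSlab τ₁ ∪ ⋃ i, Ψ i '' (boostedKerrBackground (mo i).1 (mo i).2 (M i) (a i)).truncTimeSlab (R i τ₁) τ₁)) ∧ ((∀ i, Summit.FinalStateConjecture.IsOrthochronous (mo i).1) ∧ ∀ τ : ℝ, τ₀ < τ → ∀ x ∈ (Minkowski.backgroundOn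 U₀).timeSlab τ, 𝒟.toSpacetime.timeOrientation.IsFutureDirected (mfderiv 𝓘(ℝ, E4) (𝓡 4) Ψ₀ x (E4.basisVector 0))) ∧ (∀ τ : ℝ, τ₀ < τ → 𝒟.toSpacetime.deviationCk (Minkowski.backgroundOn U₀) Ψ₀ 0 τ ≤ ENNReal.ofReal (1 / 8) ∧ ∀ i, 𝒟.toSpacetime.truncDeviationCk (boostedKerrBackground (mo i).1 (mo i).2 (M i) (a i)) (Ψ i) 0 (R i τ) τ ≤ ENNReal.ofReal (1 / 8)) ∧ (∃ B : NNReal, ∀ τ : ℝ, τ₀ < τ → 𝒟.toSpacetime.deviationCk (Minkowski.backgroundOn U₀) Ψ₀ (k + 4) τ ≤ (B : ENNReal)) ∧ (∀ R' : ℝ, ∃ B : NNReal, ∀ τ : ℝ, τ₀ < τ → ∀ i, 𝒟.toSpacetime.truncDeviationCk (boostedKerrBackground (mo i).1 (mo i).2 (M i) (a i)) (Ψ i) (k + 4) R' τ ≤ (B : ENNReal)) ∧ (∀ ε : ℝ, 0 < ε → ∃ Rf : ℝ, ∀ τ : ℝ, τ₀ < τ → supCkENorm (Subtype.val '' {x |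 x ∈ (Minkowski.backgroundOn U₀).timeSlab τ ∧ Rf ≤ ‖E4.spatial (x : E4)‖}) (k + 4) (𝒟.toSpacetime.deviationExtend (Minkowski.backgroundOn U₀) Ψ₀) ≤ ENNReal.ofReal ε)) ∧ ∀ i, (∃ κ₀ δ : ℝ, 0 < κ₀ ∧ 0 < δ ∧ ∀ τ : ℝ, τ₀ < τ → ∀ x ∈ (boostedKerrBackground (mo i).1 (mo i).2 (M i) (a i)).truncTimeSlab (Kerr.rPlus (M i) (a i) + δ) τ, κ₀ * ((boostedKerrBackground (mo i).1 (mo i).2 (M i) (a i)).radius x.1 - Kerr.rPlus (M i) (a i)) ≤ ((fderiv ℝ (fun y ↦ Kerr.radius (a i) (poincareInv (mo i).1 (mo i).2 y)) (x : E4)) (MetricCoord.sharpAt (fun y ↦ (𝒟.toSpacetime.deviationExtend (boostedKerrBackground (mo i).1 (mo i).2 (M i) (a i)) (Ψ i)) y + boostedKerrBilin (mo i).1 (mo i).2 (M i) (a i) y) (x : E4) (fderiv ℝ (fun y ↦ Kerr.radius (a i) (poincareInv (mo i).1 (mo i).2 y)) (x : E4)))))) 1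

def Sig.stub_redShiftExcludesExtremalRecurrence : Prop :=
  ∀ (k : ℕ) (X : Type) [TopologicalSpace X] [ChartedSpace E3 X] [IsManifold (𝓡 3) ∞ X] [T2Space X] [SecondCountableTopology X] [ConnectedSpace X], ∀ D ∈ admissibleVacuumData X, ∀ 𝒟 : VacuumCauchyDevelopment D, 𝒟.IsMaximal → (∃ (O : Set 𝒟.carrier) (N : ℕ) (M a : Fin N → ℝ) (mo : Fin N → lorentzGroup × E4) (τ₀ : ℝ) (Ψ : ∀ i, boostedKerrExterior (mo i).1 (mo i).2 (M i) (a i) → 𝒟.carrier) (ρ R : Fin N → ℝ → ℝ) (U₀ : Opens E4) (Ψ₀ : U₀ → 𝒟.carrier), ((∀ i, 0 < M i ∧ |a i| ≤ M i) ∧ (∀ i, 𝒟.toSpacetime.IsLateChart (boostedKerrBackground (mo i).1 (mo i).2 (M i) (a i)) O τ₀ (Ψ i)) ∧ 𝒟.toSpacetime.IsLateChart (Minkowski.backgroundOn U₀) O τ₀ Ψ₀ ∧ (∀ i, Tendsto (fun t ↦ ρ i t / t) atTop (𝓝 0)) ∧ (∀ i, Tendsto (R i) atTop atTop ∧ ∀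 τ, max (Kerr.rPlus (M i) (a i)) 0 + 1 ≤ R i τ) ∧ {x : E4 | τ₀ < x 0 ∧ ∀ i, ρ i (x 0) < Kerr.radius (a i) (poincareInv (mo i).1 (mo i).2 x)} ⊆ (U₀ : Set E4) ∧ (∀ R' : ℝ, ∃ τ₁ : ℝ, Pairwise (Function.onFun Disjoint fun i ↦ Ψ i '' (boostedKerrBackground (mo i).1 (mo i).2 (M i) (a i)).truncLateRegion τ₁ R')) ∧ O = Summit.FinalStateConjecture.exteriorOf 𝒟.toCauchyDevelopment ((⋃ i, Ψ i '' (boostedKerrBackground (mo i).1 (mo i).2 (M i) (a i)).lateRegion τ₀) ∪ Ψ₀ '' (Minkowski.backgroundOn U₀).lateRegion τ₀) ∧ Summit.FinalStateConjecture.RaysStayInClosure 𝒟.toCauchyDevelopment O ∧ (∀ τ₁ : ℝ, τ₀ < τ₁ → O \ (Ψ₀ '' (Minkowski.backgroundOn U₀).lateRegion τ₁ ∪ ⋃ i, Ψ i '' {x | τ₁ < (boostedKerrBackground (mo i).1 (mo i).2 (M i) (a i)).time x.1 ∧ (boostedKerrBackground (mo i).1 (mo i).2 (M i) (a i)).radius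 x.1 ≤ R i ((boostedKerrBackground (mo i).1 (mo i).2 (M i) (a i)).time x.1)}) ⊆ 𝒟.metric.causalPast 𝒟.timeOrientation (Ψ₀ '' (Minkowski.backgroundOn U₀).timeSlab τ₁ ∪ ⋃ i, Ψ i '' (boostedKerrBackground (mo i).1 (mo i).2 (M i) (a i)).truncTimeSlab (R i τ₁) τ₁)) ∧ ((∀ i, Summit.FinalStateConjecture.IsOrthochronous (mo i).1) ∧ ∀ τ : ℝ, τ₀ < τ → ∀ x ∈ (Minkowski.backgroundOn U₀).timeSlab τ, 𝒟.toSpacetime.timeOrientation.IsFutureDirected (mfderiv 𝓘(ℝ, E4) (𝓡 4) Ψ₀ x (E4.basisVector 0))) ∧ (∀ τ : ℝ, τ₀ < τ → 𝒟.toSpacetime.deviationCk (Minkowski.backgroundOn U₀) Ψ₀ 0 τ ≤ ENNReal.ofReal (1 / 8) ∧ ∀ i, 𝒟.toSpacetime.truncDeviationCk (boostedKerrBackground (mo i).1 (mo i).2 (M i) (a i)) (Ψ i) 0 (R i τ) τ ≤ ENNReal.ofReal (1 / 8)) ∧ (∃ B : NNReal, ∀ τ : ℝ, τ₀ < τ →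 𝒟.toSpacetime.deviationCk (Minkowski.backgroundOn U₀) Ψ₀ (k + 4) τ ≤ (B : ENNReal)) ∧ (∀ R' : ℝ, ∃ B : NNReal, ∀ τ : ℝ, τ₀ < τ → ∀ i, 𝒟.toSpacetime.truncDeviationCk (boostedKerrBackground (mo i).1 (mo i).2 (M i) (a i)) (Ψ i) (k + 4) R' τ ≤ (B : ENNReal)) ∧ (∀ ε : ℝ, 0 < ε → ∃ Rf : ℝ, ∀ τ : ℝ, τ₀ < τ → supCkENorm (Subtype.val '' {x | x ∈ (Minkowski.backgroundOn U₀).timeSlab τ ∧ Rf ≤ ‖E4.spatial (x : E4)‖}) (k + 4) (𝒟.toSpacetime.deviationExtend (Minkowski.backgroundOn U₀) Ψ₀) ≤ ENNReal.ofReal ε)) ∧ ∀ i, (∃ κ₀ δ : ℝ, 0 < κ₀ ∧ 0 < δ ∧ ∀ τ : ℝ, τ₀ < τ → ∀ x ∈ (boostedKerrBackground (mo i).1 (mo i).2 (M i) (a i)).truncTimeSlab (Kerr.rPlus (M i) (a i) + δ) τ, κ₀ * ((boostedKerrBackground (mo i).1 (mo i).2 (M i) (a i)).radius x.1 - Kerr.rPlus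 (M i) (a i)) ≤ ((fderiv ℝ (fun y ↦ Kerr.radius (a i) (poincareInv (mo i).1 (mo i).2 y)) (x : E4)) (MetricCoord.sharpAt (fun y ↦ (𝒟.toSpacetime.deviationExtend (boostedKerrBackground (mo i).1 (mo i).2 (M i) (a i)) (Ψ i)) y + boostedKerrBilin (mo i).1 (mo i).2 (M i) (a i) y) (x : E4) (fderiv ℝ (fun y ↦ Kerr.radius (a i) (poincareInv (mo i).1 (mo i).2 y)) (x : E4)))))) → ∀ (O : Set 𝒟.carrier) (N : ℕ) (M a : Fin N → ℝ) (mo : Fin N → lorentzGroup × E4) (τ₀ : ℝ) (Ψ : ∀ i, boostedKerrExterior (mo i).1 (mo i).2 (M i) (a i) → 𝒟.carrier) (ρ R : Fin N → ℝ → ℝ) (U₀ : Opens E4) (Ψ₀ : U₀ → 𝒟.carrier), (∀ i, 0 < M i ∧ |a i| ≤ M i) ∧ (∀ i, 𝒟.toSpacetime.IsLateChart (boostedKerrBackground (mo i).1 (mo i).2 (M i) (a i)) O τ₀ (Ψ i)) ∧ 𝒟.toSpacetime.IsLateChart (Minkowski.backgroundOn U₀) O τ₀ Ψ₀ ∧ (∀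 i, Tendsto (fun t ↦ ρ i t / t) atTop (𝓝 0)) ∧ (∀ i, Tendsto (R i) atTop atTop ∧ ∀ τ, max (Kerr.rPlus (M i) (a i)) 0 + 1 ≤ R i τ) ∧ {x : E4 | τ₀ < x 0 ∧ ∀ i, ρ i (x 0) < Kerr.radius (a i) (poincareInv (mo i).1 (mo i).2 x)} ⊆ (U₀ : Set E4) ∧ (∀ R' : ℝ, ∃ τ₁ : ℝ, Pairwise (Function.onFun Disjoint fun i ↦ Ψ i '' (boostedKerrBackground (mo i).1 (mo i).2 (M i) (a i)).truncLateRegion τ₁ R')) ∧ O = Summit.FinalStateConjecture.exteriorOf 𝒟.toCauchyDevelopment ((⋃ i, Ψ i '' (boostedKerrBackground (mo i).1 (mo i).2 (M i) (a i)).lateRegion τ₀) ∪ Ψ₀ '' (Minkowski.backgroundOn U₀).lateRegion τ₀) ∧ Summit.FinalStateConjecture.RaysStayInClosure 𝒟.toCauchyDevelopment O ∧ (∀ τ₁ : ℝ, τ₀ < τ₁ → O \ (Ψ₀ '' (Minkowski.backgroundOn U₀).lateRegion τ₁ ∪ ⋃ i, Ψ i '' {x | τ₁ < (boostedKerrBackground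 (mo i).1 (mo i).2 (M i) (a i)).time x.1 ∧ (boostedKerrBackground (mo i).1 (mo i).2 (M i) (a i)).radius x.1 ≤ R i ((boostedKerrBackground (mo i).1 (mo i).2 (M i) (a i)).time x.1)}) ⊆ 𝒟.metric.causalPast 𝒟.timeOrientation (Ψ₀ '' (Minkowski.backgroundOn U₀).timeSlab τ₁ ∪ ⋃ i, Ψ i '' (boostedKerrBackground (mo i).1 (mo i).2 (M i) (a i)).truncTimeSlab (R i τ₁) τ₁)) ∧ ((∀ i, Summit.FinalStateConjecture.IsOrthochronous (mo i).1) ∧ ∀ τ : ℝ, τ₀ < τ → ∀ x ∈ (Minkowski.backgroundOn U₀).timeSlab τ, 𝒟.toSpacetime.timeOrientation.IsFutureDirected (mfderiv 𝓘(ℝ, E4) (𝓡 4) Ψ₀ x (E4.basisVector 0))) ∧ (∀ τ : ℝ, τ₀ < τ → 𝒟.toSpacetime.deviationCk (Minkowski.backgroundOn U₀) Ψ₀ 0 τ ≤ ENNReal.ofReal (1 / 4) ∧ ∀ i, 𝒟.toSpacetime.truncDeviationCk (boostedKerrBackground (mo i).1 (mo i).2 (M i) (a i)) (Ψ i) 0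 (R i τ) τ ≤ ENNReal.ofReal (1 / 4)) ∧ (∀ R' : ℝ, ∀ ε : ℝ, 0 < ε → ∃ᶠ τ in atTop, 𝒟.toSpacetime.deviationCk (Minkowski.backgroundOn U₀) Ψ₀ (k + 2) τ ≤ ENNReal.ofReal ε ∧ ∀ i, 𝒟.toSpacetime.truncDeviationCk (boostedKerrBackground (mo i).1 (mo i).2 (M i) (a i)) (Ψ i) (k + 2) R' τ ≤ ENNReal.ofReal ε ∧ ∀ x ∈ (boostedKerrBackground (mo i).1 (mo i).2 (M i) (a i)).truncTimeSlab R' τ, 𝒟.toSpacetime.timeOrientation.IsFutureDirected (mfderiv 𝓘(ℝ, E4) (𝓡 4) (Ψ i) x (((mo i).1 : E4 ≃L[ℝ] E4) (Kerr.timeVector (M i) (a i) (poincareInv (mo i).1 (mo i).2 (x : E4)))))) → ∀ i, Kerr.IsSubextremal (M i) (a i)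

def Sig.stub_eraHorizonNull : Prop :=
  ∀ (k : ℕ) (X : Type) [TopologicalSpace X] [ChartedSpace E3 X] [IsManifold (𝓡 3) ∞ X] [T2Space X] [SecondCountableTopology X] [ConnectedSpace X], ∀ D ∈ admissibleVacuumData X, ∀ 𝒟 : VacuumCauchyDevelopment D, 𝒟.IsMaximal → ∀ (O : Set 𝒟.carrier) (N : ℕ) (M a : Fin N → ℝ) (mo : Fin N → lorentzGroup × E4) (τ₀ : ℝ) (Ψ : ∀ i, boostedKerrExterior (mo i).1 (mo i).2 (M i) (a i) → 𝒟.carrier) (ρ R : Fin N → ℝ → ℝ) (U₀ : Opens E4) (Ψ₀ : U₀ → 𝒟.carrier), (∀ i, 0 < M i ∧ |a i| ≤ M i) ∧ (∀ i, 𝒟.toSpacetime.IsLateChart (boostedKerrBackground (mo i).1 (mo i).2 (M i) (a i)) O τ₀ (Ψ i)) ∧ 𝒟.toSpacetime.IsLateChart (Minkowski.backgroundOn U₀) O τ₀ Ψ₀ ∧ (∀ i, Tendsto (fun t ↦ ρ i t / t) atTop (𝓝 0)) ∧ (∀ i, Tendsto (R i) atTop atTop ∧ ∀ τ, max (Kerr.rPlus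 (M i) (a i)) 0 + 1 ≤ R i τ) ∧ {x : E4 | τ₀ < x 0 ∧ ∀ i, ρ i (x 0) < Kerr.radius (a i) (poincareInv (mo i).1 (mo i).2 x)} ⊆ (U₀ : Set E4) ∧ (∀ R' : ℝ, ∃ τ₁ : ℝ, Pairwise (Function.onFun Disjoint fun i ↦ Ψ i '' (boostedKerrBackground (mo i).1 (mo i).2 (M i) (a i)).truncLateRegion τ₁ R')) ∧ O = Summit.FinalStateConjecture.exteriorOf 𝒟.toCauchyDevelopment ((⋃ i, Ψ i '' (boostedKerrBackground (mo i).1 (mo i).2 (M i) (a i)).lateRegion τ₀) ∪ Ψ₀ '' (Minkowski.backgroundOn U₀).lateRegion τ₀) ∧ Summit.FinalStateConjecture.RaysStayInClosure 𝒟.toCauchyDevelopment O ∧ (∀ τ₁ : ℝ, τ₀ < τ₁ → O \ (Ψ₀ '' (Minkowski.backgroundOn U₀).lateRegion τ₁ ∪ ⋃ i, Ψ i '' {x | τ₁ < (boostedKerrBackground (mo i).1 (mo i).2 (M i) (a i)).time x.1 ∧ (boostedKerrBackground (mo i).1 (mo i).2 (M i) (a i)).radius x.1 ≤ R i ((boostedKerrBackground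 (mo i).1 (mo i).2 (M i) (a i)).time x.1)}) ⊆ 𝒟.metric.causalPast 𝒟.timeOrientation (Ψ₀ '' (Minkowski.backgroundOn U₀).timeSlab τ₁ ∪ ⋃ i, Ψ i '' (boostedKerrBackground (mo i).1 (mo i).2 (M i) (a i)).truncTimeSlab (R i τ₁) τ₁)) ∧ ((∀ i, Summit.FinalStateConjecture.IsOrthochronous (mo i).1) ∧ ∀ τ : ℝ, τ₀ < τ → ∀ x ∈ (Minkowski.backgroundOn U₀).timeSlab τ, 𝒟.toSpacetime.timeOrientation.IsFutureDirected (mfderiv 𝓘(ℝ, E4) (𝓡 4) Ψ₀ x (E4.basisVector 0))) ∧ (∀ τ : ℝ, τ₀ < τ → 𝒟.toSpacetime.deviationCk (Minkowski.backgroundOn U₀) Ψ₀ 0 τ ≤ ENNReal.ofReal (1 / 8) ∧ ∀ i, 𝒟.toSpacetime.truncDeviationCk (boostedKerrBackground (mo i).1 (mo i).2 (M i) (a i)) (Ψ i) 0 (R i τ) τ ≤ ENNReal.ofReal (1 / 8)) ∧ (∃ B : NNReal, ∀ τ : ℝ, τ₀ < τ → 𝒟.toSpacetime.deviationCk (Minkowski.backgroundOn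 U₀) Ψ₀ (k + 4) τ ≤ (B : ENNReal)) ∧ (∀ R' : ℝ, ∃ B : NNReal, ∀ τ : ℝ, τ₀ < τ → ∀ i, 𝒟.toSpacetime.truncDeviationCk (boostedKerrBackground (mo i).1 (mo i).2 (M i) (a i)) (Ψ i) (k + 4) R' τ ≤ (B : ENNReal)) ∧ (∀ ε : ℝ, 0 < ε → ∃ Rf : ℝ, ∀ τ : ℝ, τ₀ < τ → supCkENorm (Subtype.val '' {x | x ∈ (Minkowski.backgroundOn U₀).timeSlab τ ∧ Rf ≤ ‖E4.spatial (x : E4)‖}) (k + 4) (𝒟.toSpacetime.deviationExtend (Minkowski.backgroundOn U₀) Ψ₀) ≤ ENNReal.ofReal ε) → ∀ i, (∀ ε : ℝ, 0 < ε → ∃ δ : ℝ, 0 < δ ∧ ∀ τ : ℝ, τ₀ < τ → ∀ x ∈ (boostedKerrBackground (mo i).1 (mo i).2 (M i) (a i)).truncTimeSlab (Kerr.rPlus (M i) (a i) + δ) τ, |((fderiv ℝ (fun y ↦ Kerr.radius (a i) (poincareInv (mo i).1 (mo i).2 y)) (x : E4)) (MetricCoord.sharpAt (fun y ↦ (𝒟.toSpacetime.deviationExtend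 (boostedKerrBackground (mo i).1 (mo i).2 (M i) (a i)) (Ψ i)) y + boostedKerrBilin (mo i).1 (mo i).2 (M i) (a i) y) (x : E4) (fderiv ℝ (fun y ↦ Kerr.radius (a i) (poincareInv (mo i).1 (mo i).2 y)) (x : E4))))| ≤ ε)

def Sig.stub_asymptoticallyStationaryEra : Prop :=
  ∀ (k : ℕ) (X : Type) [TopologicalSpace X] [ChartedSpace E3 X] [IsManifold (𝓡 3) ∞ X] [T2Space X] [SecondCountableTopology X] [ConnectedSpace X], ∀ D ∈ admissibleVacuumData X, ∀ 𝒟 : VacuumCauchyDevelopment D, 𝒟.IsMaximal → ¬ (Summit.FinalStateConjecture.HasCompleteNullInfinity 𝒟.toCauchyDevelopment ∧ ∃ (O : Set 𝒟.carrier) (d : FinalStateDecomposition 𝒟.toSpacetime O 2), (∀ i, Kerr.IsSubextremal (d.mass i) (d.spin i)) ∧ O = Summit.FinalStateConjecture.exteriorOf 𝒟.toCauchyDevelopment d.charted ∧ Summit.FinalStateConjecture.RaysStayInClosure 𝒟.toCauchyDevelopment O ∧ Summit.FinalStateConjecture.HasExhaustiveCharts d ∧ Summit.FinalStateConjecture.IsFutureOriented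 d) → ∀ (O : Set 𝒟.carrier) (N : ℕ) (M a : Fin N → ℝ) (mo : Fin N → lorentzGroup × E4) (τ₀ : ℝ) (Ψ : ∀ i, boostedKerrExterior (mo i).1 (mo i).2 (M i) (a i) → 𝒟.carrier) (ρ R : Fin N → ℝ → ℝ) (U₀ : Opens E4) (Ψ₀ : U₀ → 𝒟.carrier), (∀ i, 0 < M i ∧ |a i| ≤ M i) ∧ (∀ i, 𝒟.toSpacetime.IsLateChart (boostedKerrBackground (mo i).1 (mo i).2 (M i) (a i)) O τ₀ (Ψ i)) ∧ 𝒟.toSpacetime.IsLateChart (Minkowski.backgroundOn U₀) O τ₀ Ψ₀ ∧ (∀ i, Tendsto (fun t ↦ ρ i t / t) atTop (𝓝 0)) ∧ (∀ i, Tendsto (R i) atTop atTop ∧ ∀ τ, max (Kerr.rPlus (M i) (a i)) 0 + 1 ≤ R i τ) ∧ {x : E4 | τ₀ < x 0 ∧ ∀ i, ρ i (x 0) < Kerr.radius (a i) (poincareInv (mo i).1 (mo i).2 x)} ⊆ (U₀ : Set E4) ∧ (∀ R' : ℝ, ∃ τ₁ : ℝ, Pairwise (Function.onFun Disjoint fun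 i ↦ Ψ i '' (boostedKerrBackground (mo i).1 (mo i).2 (M i) (a i)).truncLateRegion τ₁ R')) ∧ O = Summit.FinalStateConjecture.exteriorOf 𝒟.toCauchyDevelopment ((⋃ i, Ψ i '' (boostedKerrBackground (mo i).1 (mo i).2 (M i) (a i)).lateRegion τ₀) ∪ Ψ₀ '' (Minkowski.backgroundOn U₀).lateRegion τ₀) ∧ Summit.FinalStateConjecture.RaysStayInClosure 𝒟.toCauchyDevelopment O ∧ (∀ τ₁ : ℝ, τ₀ < τ₁ → O \ (Ψ₀ '' (Minkowski.backgroundOn U₀).lateRegion τ₁ ∪ ⋃ i, Ψ i '' {x | τ₁ < (boostedKerrBackground (mo i).1 (mo i).2 (M i) (a i)).time x.1 ∧ (boostedKerrBackground (mo i).1 (mo i).2 (M i) (a i)).radius x.1 ≤ R i ((boostedKerrBackground (mo i).1 (mo i).2 (M i) (a i)).time x.1)}) ⊆ 𝒟.metric.causalPast 𝒟.timeOrientation (Ψ₀ '' (Minkowski.backgroundOn U₀).timeSlab τ₁ ∪ ⋃ i, Ψ i '' (boostedKerrBackground (mo i).1 (mo i).2 (M i) (a i)).truncTimeSlab (R i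 τ₁) τ₁)) ∧ ((∀ i, Summit.FinalStateConjecture.IsOrthochronous (mo i).1) ∧ ∀ τ : ℝ, τ₀ < τ → ∀ x ∈ (Minkowski.backgroundOn U₀).timeSlab τ, 𝒟.toSpacetime.timeOrientation.IsFutureDirected (mfderiv 𝓘(ℝ, E4) (𝓡 4) Ψ₀ x (E4.basisVector 0))) ∧ (∀ τ : ℝ, τ₀ < τ → 𝒟.toSpacetime.deviationCk (Minkowski.backgroundOn U₀) Ψ₀ 0 τ ≤ ENNReal.ofReal (1 / 8) ∧ ∀ i, 𝒟.toSpacetime.truncDeviationCk (boostedKerrBackground (mo i).1 (mo i).2 (M i) (a i)) (Ψ i) 0 (R i τ) τ ≤ ENNReal.ofReal (1 / 8)) ∧ (∃ B : NNReal, ∀ τ : ℝ, τ₀ < τ → 𝒟.toSpacetime.deviationCk (Minkowski.backgroundOn U₀) Ψ₀ (k + 4) τ ≤ (B : ENNReal)) ∧ (∀ R' : ℝ, ∃ B : NNReal, ∀ τ : ℝ, τ₀ < τ → ∀ i, 𝒟.toSpacetime.truncDeviationCk (boostedKerrBackground (mo i).1 (mo i).2 (M i) (a i)) (Ψ i) (k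 + 4) R' τ ≤ (B : ENNReal)) ∧ (∀ ε : ℝ, 0 < ε → ∃ Rf : ℝ, ∀ τ : ℝ, τ₀ < τ → supCkENorm (Subtype.val '' {x | x ∈ (Minkowski.backgroundOn U₀).timeSlab τ ∧ Rf ≤ ‖E4.spatial (x : E4)‖}) (k + 4) (𝒟.toSpacetime.deviationExtend (Minkowski.backgroundOn U₀) Ψ₀) ≤ ENNReal.ofReal ε) → (∀ i (R' : ℝ), Tendsto (fun τ ↦ supCkENorm (Subtype.val '' (boostedKerrBackground (mo i).1 (mo i).2 (M i) (a i)).truncTimeSlab R' τ) (k + 2) (fun y ↦ fderiv ℝ (𝒟.toSpacetime.deviationExtend (boostedKerrBackground (mo i).1 (mo i).2 (M i) (a i)) (Ψ i)) y (((mo i).1 : E4 ≃L[ℝ] E4) (E4.basisVector 0)))) atTop (𝓝 0)) ∧ Tendsto (fun τ ↦ supCkENorm (Subtype.val '' (Minkowski.backgroundOn U₀).timeSlab τ) (k + 2) (fun y ↦ fderiv ℝ (𝒟.toSpacetime.deviationExtend (Minkowski.backgroundOn U₀) Ψ₀) y (E4.basisVector 0))) atTop (𝓝 0)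

def Sig.stub_noHairUpToGauge : Prop :=
  ∀ k : ℕ, ∀ (Λ : lorentzGroup) (c : E4) (M a : ℝ), 0 < M → |a| ≤ M → ∀ (G : E4 → E4 →L[ℝ] E4 →L[ℝ] ℝ), ContDiffOn ℝ (k + 3) G (boostedKerrExterior Λ c M a : Set E4) → (∀ x ∈ (boostedKerrExterior Λ c M a : Set E4), (G x).IsInvertible ∧ (∀ v w : E4, G x v w = G x w v) ∧ ∃ v : E4, G x v v < 0 ∧ ∀ w : E4, G x v w = 0 → w ≠ 0 → 0 < G x w w) → (∀ x ∈ (boostedKerrExterior Λ c M a : Set E4), MetricCoord.ricAt G x = 0) → (∀ x ∈ (boostedKerrExterior Λ c M a : Set E4), ‖G x - boostedKerrBilin Λ c M a x‖ ≤ 1 / 4) → (∀ R' : ℝ, ∃ C : ℝ, ∀ x ∈ (boostedKerrExterior Λ c M a : Set E4), Kerr.radius a (poincareInv Λ c x) ≤ R' → ∀ j : ℕ, j ≤ k + 3 → ‖iteratedFDeriv ℝ j G x‖ ≤ C) → (∀ x ∈ (boostedKerrExterior Λ c M a : Set E4), ∀ s : ℝ, G (x + s • ((Λ : E4 ≃L[ℝ]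 E4) (E4.basisVector 0))) = G x) → (∀ ε : ℝ, 0 < ε → ∃ δ : ℝ, 0 < δ ∧ ∀ x ∈ (boostedKerrExterior Λ c M a : Set E4), Kerr.radius a (poincareInv Λ c x) < Kerr.rPlus M a + δ → |((fderiv ℝ (fun y ↦ Kerr.radius a (poincareInv Λ c y)) x) (MetricCoord.sharpAt G x (fderiv ℝ (fun y ↦ Kerr.radius a (poincareInv Λ c y)) x)))| ≤ ε) → ∃ (M' a' : ℝ) (Λ' : lorentzGroup) (c' : E4) (θ : E4 → E4), 0 < M' ∧ |a'| ≤ M' ∧ (Λ' : E4 ≃L[ℝ] E4) (E4.basisVector 0) = ((Λ : E4 ≃L[ℝ] E4) (E4.basisVector 0)) ∧ ContDiffOn ℝ (k + 3) θ (boostedKerrExterior Λ' c' M' a' : Set E4) ∧ Set.InjOn θ (boostedKerrExterior Λ' c' M' a' : Set E4) ∧ θ '' (boostedKerrExterior Λ' c' M' a' : Set E4) = (boostedKerrExterior Λ c M a : Set E4) ∧ (∀ x ∈ (boostedKerrExterior Λ' c' M' a' : Set E4), ∀ s : ℝ, θ (x + s • ((Λ : E4 ≃L[ℝ] E4) (E4.basisVector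 0))) = θ x + s • ((Λ : E4 ≃L[ℝ] E4) (E4.basisVector 0))) ∧ ∀ x ∈ (boostedKerrExterior Λ' c' M' a' : Set E4), ∀ v w : E4, G (θ x) (fderiv ℝ θ x v) (fderiv ℝ θ x w) = boostedKerrBilin Λ' c' M' a' x v w

def Sig.stub_rebase : Prop :=
  ∀ (k : ℕ) (X : Type) [TopologicalSpace X] [ChartedSpace E3 X] [IsManifold (𝓡 3) ∞ X] [T2Space X] [SecondCountableTopology X] [ConnectedSpace X], ∀ D ∈ admissibleVacuumData X, ∀ 𝒟 : VacuumCauchyDevelopment D, 𝒟.IsMaximal → ¬ (Summit.FinalStateConjecture.HasCompleteNullInfinity 𝒟.toCauchyDevelopment ∧ ∃ (O : Set 𝒟.carrier) (d : FinalStateDecomposition 𝒟.toSpacetime O 2), (∀ i, Kerr.IsSubextremal (d.mass i) (d.spin i)) ∧ O = Summit.FinalStateConjecture.exteriorOf 𝒟.toCauchyDevelopment d.charted ∧ Summit.FinalStateConjecture.RaysStayInClosure 𝒟.toCauchyDevelopment O ∧ Summit.FinalStateConjecture.HasExhaustiveCharts d ∧ Summit.FinalStateConjecture.IsFutureOriented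 d) → (∀ (Λ : lorentzGroup) (c : E4) (M a : ℝ), 0 < M → |a| ≤ M → ∀ (G : E4 → E4 →L[ℝ] E4 →L[ℝ] ℝ), ContDiffOn ℝ (k + 3) G (boostedKerrExterior Λ c M a : Set E4) → (∀ x ∈ (boostedKerrExterior Λ c M a : Set E4), (G x).IsInvertible ∧ (∀ v w : E4, G x v w = G x w v) ∧ ∃ v : E4, G x v v < 0 ∧ ∀ w : E4, G x v w = 0 → w ≠ 0 → 0 < G x w w) → (∀ x ∈ (boostedKerrExterior Λ c M a : Set E4), MetricCoord.ricAt G x = 0) → (∀ x ∈ (boostedKerrExterior Λ c M a : Set E4), ‖G x - boostedKerrBilin Λ c M a x‖ ≤ 1 / 4) → (∀ R' : ℝ, ∃ C : ℝ, ∀ x ∈ (boostedKerrExterior Λ c M a : Set E4), Kerr.radius a (poincareInv Λ c x) ≤ R' → ∀ j : ℕ, j ≤ k + 3 → ‖iteratedFDeriv ℝ j G x‖ ≤ C) → (∀ x ∈ (boostedKerrExterior Λ c M a : Set E4), ∀ s : ℝ, G (x + s • ((Λ : E4 ≃L[ℝ] E4) (E4.basisVector 0))) = G x) → (∀ ε :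 ℝ, 0 < ε → ∃ δ : ℝ, 0 < δ ∧ ∀ x ∈ (boostedKerrExterior Λ c M a : Set E4), Kerr.radius a (poincareInv Λ c x) < Kerr.rPlus M a + δ → |((fderiv ℝ (fun y ↦ Kerr.radius a (poincareInv Λ c y)) x) (MetricCoord.sharpAt G x (fderiv ℝ (fun y ↦ Kerr.radius a (poincareInv Λ c y)) x)))| ≤ ε) → ∃ (M' a' : ℝ) (Λ' : lorentzGroup) (c' : E4) (θ : E4 → E4), 0 < M' ∧ |a'| ≤ M' ∧ (Λ' : E4 ≃L[ℝ] E4) (E4.basisVector 0) = ((Λ : E4 ≃L[ℝ] E4) (E4.basisVector 0)) ∧ ContDiffOn ℝ (k + 3) θ (boostedKerrExterior Λ' c' M' a' : Set E4) ∧ Set.InjOn θ (boostedKerrExterior Λ' c' M' a' : Set E4) ∧ θ '' (boostedKerrExterior Λ' c' M' a' : Set E4) = (boostedKerrExterior Λ c M a : Set E4) ∧ (∀ x ∈ (boostedKerrExterior Λ' c' M' a' : Set E4), ∀ s : ℝ, θ (x + s • ((Λ : E4 ≃L[ℝ] E4) (E4.basisVector 0))) = θ x + s • ((Λ : E4 ≃L[ℝ]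 E4) (E4.basisVector 0))) ∧ ∀ x ∈ (boostedKerrExterior Λ' c' M' a' : Set E4), ∀ v w : E4, G (θ x) (fderiv ℝ θ x v) (fderiv ℝ θ x w) = boostedKerrBilin Λ' c' M' a' x v w) → ∀ (O : Set 𝒟.carrier) (N : ℕ) (M a : Fin N → ℝ) (mo : Fin N → lorentzGroup × E4) (τ₀ : ℝ) (Ψ : ∀ i, boostedKerrExterior (mo i).1 (mo i).2 (M i) (a i) → 𝒟.carrier) (ρ R : Fin N → ℝ → ℝ) (U₀ : Opens E4) (Ψ₀ : U₀ → 𝒟.carrier), (∀ i, 0 < M i ∧ |a i| ≤ M i) ∧ (∀ i, 𝒟.toSpacetime.IsLateChart (boostedKerrBackground (mo i).1 (mo i).2 (M i) (a i)) O τ₀ (Ψ i)) ∧ 𝒟.toSpacetime.IsLateChart (Minkowski.backgroundOn U₀) O τ₀ Ψ₀ ∧ (∀ i, Tendsto (fun t ↦ ρ i t / t) atTop (𝓝 0)) ∧ (∀ i, Tendsto (R i) atTop atTop ∧ ∀ τ, max (Kerr.rPlus (M i) (a i)) 0 + 1 ≤ R i τ) ∧ {x : E4 | τ₀ < x 0 ∧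 ∀ i, ρ i (x 0) < Kerr.radius (a i) (poincareInv (mo i).1 (mo i).2 x)} ⊆ (U₀ : Set E4) ∧ (∀ R' : ℝ, ∃ τ₁ : ℝ, Pairwise (Function.onFun Disjoint fun i ↦ Ψ i '' (boostedKerrBackground (mo i).1 (mo i).2 (M i) (a i)).truncLateRegion τ₁ R')) ∧ O = Summit.FinalStateConjecture.exteriorOf 𝒟.toCauchyDevelopment ((⋃ i, Ψ i '' (boostedKerrBackground (mo i).1 (mo i).2 (M i) (a i)).lateRegion τ₀) ∪ Ψ₀ '' (Minkowski.backgroundOn U₀).lateRegion τ₀) ∧ Summit.FinalStateConjecture.RaysStayInClosure 𝒟.toCauchyDevelopment O ∧ (∀ τ₁ : ℝ, τ₀ < τ₁ → O \ (Ψ₀ '' (Minkowski.backgroundOn U₀).lateRegion τ₁ ∪ ⋃ i, Ψ i '' {x | τ₁ < (boostedKerrBackground (mo i).1 (mo i).2 (M i) (a i)).time x.1 ∧ (boostedKerrBackground (mo i).1 (mo i).2 (M i) (a i)).radius x.1 ≤ R i ((boostedKerrBackground (mo i).1 (mo i).2 (M i) (a i)).time x.1)}) ⊆ 𝒟.metric.causalPast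 𝒟.timeOrientation (Ψ₀ '' (Minkowski.backgroundOn U₀).timeSlab τ₁ ∪ ⋃ i, Ψ i '' (boostedKerrBackground (mo i).1 (mo i).2 (M i) (a i)).truncTimeSlab (R i τ₁) τ₁)) ∧ ((∀ i, Summit.FinalStateConjecture.IsOrthochronous (mo i).1) ∧ ∀ τ : ℝ, τ₀ < τ → ∀ x ∈ (Minkowski.backgroundOn U₀).timeSlab τ, 𝒟.toSpacetime.timeOrientation.IsFutureDirected (mfderiv 𝓘(ℝ, E4) (𝓡 4) Ψ₀ x (E4.basisVector 0))) ∧ (∀ τ : ℝ, τ₀ < τ → 𝒟.toSpacetime.deviationCk (Minkowski.backgroundOn U₀) Ψ₀ 0 τ ≤ ENNReal.ofReal (1 / 8) ∧ ∀ i, 𝒟.toSpacetime.truncDeviationCk (boostedKerrBackground (mo i).1 (mo i).2 (M i) (a i)) (Ψ i) 0 (R i τ) τ ≤ ENNReal.ofReal (1 / 8)) ∧ (∃ B : NNReal, ∀ τ : ℝ, τ₀ < τ → 𝒟.toSpacetime.deviationCk (Minkowski.backgroundOn U₀) Ψ₀ (k + 4) τ ≤ (B : ENNReal)) ∧ (∀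 R' : ℝ, ∃ B : NNReal, ∀ τ : ℝ, τ₀ < τ → ∀ i, 𝒟.toSpacetime.truncDeviationCk (boostedKerrBackground (mo i).1 (mo i).2 (M i) (a i)) (Ψ i) (k + 4) R' τ ≤ (B : ENNReal)) ∧ (∀ ε : ℝ, 0 < ε → ∃ Rf : ℝ, ∀ τ : ℝ, τ₀ < τ → supCkENorm (Subtype.val '' {x | x ∈ (Minkowski.backgroundOn U₀).timeSlab τ ∧ Rf ≤ ‖E4.spatial (x : E4)‖}) (k + 4) (𝒟.toSpacetime.deviationExtend (Minkowski.backgroundOn U₀) Ψ₀) ≤ ENNReal.ofReal ε) → (∀ i, (∀ ε : ℝ, 0 < ε → ∃ δ : ℝ, 0 < δ ∧ ∀ τ : ℝ, τ₀ < τ → ∀ x ∈ (boostedKerrBackground (mo i).1 (mo i).2 (M i) (a i)).truncTimeSlab (Kerr.rPlus (M i) (a i) + δ) τ, |((fderiv ℝ (fun y ↦ Kerr.radius (a i) (poincareInv (mo i).1 (mo i).2 y)) (x : E4)) (MetricCoord.sharpAt (fun y ↦ (𝒟.toSpacetime.deviationExtend (boostedKerrBackground (mo i).1 (mo i).2 (M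 i) (a i)) (Ψ i)) y + boostedKerrBilin (mo i).1 (mo i).2 (M i) (a i) y) (x : E4) (fderiv ℝ (fun y ↦ Kerr.radius (a i) (poincareInv (mo i).1 (mo i).2 y)) (x : E4))))| ≤ ε)) → (∀ i (R' : ℝ), Tendsto (fun τ ↦ supCkENorm (Subtype.val '' (boostedKerrBackground (mo i).1 (mo i).2 (M i) (a i)).truncTimeSlab R' τ) (k + 2) (fun y ↦ fderiv ℝ (𝒟.toSpacetime.deviationExtend (boostedKerrBackground (mo i).1 (mo i).2 (M i) (a i)) (Ψ i)) y (((mo i).1 : E4 ≃L[ℝ] E4) (E4.basisVector 0)))) atTop (𝓝 0)) ∧ Tendsto (fun τ ↦ supCkENorm (Subtype.val '' (Minkowski.backgroundOn U₀).timeSlab τ) (k + 2) (fun y ↦ fderiv ℝ (𝒟.toSpacetime.deviationExtend (Minkowski.backgroundOn U₀) Ψ₀) y (E4.basisVector 0))) atTop (𝓝 0) → ∃ (O : Set 𝒟.carrier) (N : ℕ) (M a : Fin N → ℝ) (mo : Fin N → lorentzGroup × E4) (τ₀ : ℝ) (Ψ : ∀ i, boostedKerrExterior (mo i).1 (mo i).2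 (M i) (a i) → 𝒟.carrier) (ρ R : Fin N → ℝ → ℝ) (U₀ : Opens E4) (Ψ₀ : U₀ → 𝒟.carrier), (∀ i, 0 < M i ∧ |a i| ≤ M i) ∧ (∀ i, 𝒟.toSpacetime.IsLateChart (boostedKerrBackground (mo i).1 (mo i).2 (M i) (a i)) O τ₀ (Ψ i)) ∧ 𝒟.toSpacetime.IsLateChart (Minkowski.backgroundOn U₀) O τ₀ Ψ₀ ∧ (∀ i, Tendsto (fun t ↦ ρ i t / t) atTop (𝓝 0)) ∧ (∀ i, Tendsto (R i) atTop atTop ∧ ∀ τ, max (Kerr.rPlus (M i) (a i)) 0 + 1 ≤ R i τ) ∧ {x : E4 | τ₀ < x 0 ∧ ∀ i, ρ i (x 0) < Kerr.radius (a i) (poincareInv (mo i).1 (mo i).2 x)} ⊆ (U₀ : Set E4) ∧ (∀ R' : ℝ, ∃ τ₁ : ℝ, Pairwise (Function.onFun Disjoint fun i ↦ Ψ i '' (boostedKerrBackground (mo i).1 (mo i).2 (M i) (a i)).truncLateRegion τ₁ R')) ∧ O = Summit.FinalStateConjecture.exteriorOf 𝒟.toCauchyDevelopment ((⋃ i, Ψ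 i '' (boostedKerrBackground (mo i).1 (mo i).2 (M i) (a i)).lateRegion τ₀) ∪ Ψ₀ '' (Minkowski.backgroundOn U₀).lateRegion τ₀) ∧ Summit.FinalStateConjecture.RaysStayInClosure 𝒟.toCauchyDevelopment O ∧ (∀ τ₁ : ℝ, τ₀ < τ₁ → O \ (Ψ₀ '' (Minkowski.backgroundOn U₀).lateRegion τ₁ ∪ ⋃ i, Ψ i '' {x | τ₁ < (boostedKerrBackground (mo i).1 (mo i).2 (M i) (a i)).time x.1 ∧ (boostedKerrBackground (mo i).1 (mo i).2 (M i) (a i)).radius x.1 ≤ R i ((boostedKerrBackground (mo i).1 (mo i).2 (M i) (a i)).time x.1)}) ⊆ 𝒟.metric.causalPast 𝒟.timeOrientation (Ψ₀ '' (Minkowski.backgroundOn U₀).timeSlab τ₁ ∪ ⋃ i, Ψ i '' (boostedKerrBackground (mo i).1 (mo i).2 (M i) (a i)).truncTimeSlab (R i τ₁) τ₁)) ∧ ((∀ i, Summit.FinalStateConjecture.IsOrthochronous (mo i).1) ∧ ∀ τ : ℝ, τ₀ < τ → ∀ x ∈ (Minkowski.backgroundOn U₀).timeSlab τ, 𝒟.toSpacetime.timeOrientation.IsFutureDirected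 (mfderiv 𝓘(ℝ, E4) (𝓡 4) Ψ₀ x (E4.basisVector 0))) ∧ (∀ τ : ℝ, τ₀ < τ → 𝒟.toSpacetime.deviationCk (Minkowski.backgroundOn U₀) Ψ₀ 0 τ ≤ ENNReal.ofReal (1 / 4) ∧ ∀ i, 𝒟.toSpacetime.truncDeviationCk (boostedKerrBackground (mo i).1 (mo i).2 (M i) (a i)) (Ψ i) 0 (R i τ) τ ≤ ENNReal.ofReal (1 / 4)) ∧ ∀ R' : ℝ, ∀ ε : ℝ, 0 < ε → ∃ᶠ τ in atTop, 𝒟.toSpacetime.deviationCk (Minkowski.backgroundOn U₀) Ψ₀ (k + 2) τ ≤ ENNReal.ofReal ε ∧ ∀ i, 𝒟.toSpacetime.truncDeviationCk (boostedKerrBackground (mo i).1 (mo i).2 (M i) (a i)) (Ψ i) (k + 2) R' τ ≤ ENNReal.ofReal ε ∧ ∀ x ∈ (boostedKerrBackground (mo i).1 (mo i).2 (M i) (a i)).truncTimeSlab R' τ, 𝒟.toSpacetime.timeOrientation.IsFutureDirected (mfderiv 𝓘(ℝ, E4) (𝓡 4) (Ψ i) x (((mo i).1 : E4 ≃L[ℝ]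 E4) (Kerr.timeVector (M i) (a i) (poincareInv (mo i).1 (mo i).2 (x : E4)))))

/-- Tame Christodoulou genericity is monotone under pointwise implication on the class (the same
tame immersed family through an exceptional datum works). Local copy (as in `Lines/birth.lean`). [folklore] -/
theorem isTameChristodoulouGeneric_mono {X : Type} [TopologicalSpace X] [ChartedSpace E3 X]
    [IsManifold (𝓡 3) ∞ X] {𝓓 : Set (InitialDataSet (𝓡 3) X)}
    {P Q : InitialDataSet (𝓡 3) X → Prop} {m : ℕ}
    (h : InitialDataSet.IsTameChristodoulouGeneric 𝓓 P m) (hPQ : ∀ d ∈ 𝓓, P d → Q d) :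
    InitialDataSet.IsTameChristodoulouGeneric 𝓓 Q m := by
  intro d hd
  obtain ⟨e, F, hF, himm, h0, hinj, hadm, hexc⟩ := h d ⟨hd.1, fun hP ↦ hd.2 (hPQ d hd.1 hP)⟩
  exact ⟨e, F, hF, himm, h0, hinj, hadm,
    fun c hc hmem ↦ hexc c hc ⟨hmem.1, fun hP ↦ hmem.2 (hPQ _ hmem.1 hP)⟩⟩

/-! ### The registered stubs (the ONLY sorries of this file) -/

/-- **STUB 1 `stub_genericTameEraRedShift` (GENERIC; the summit pre-phase without identification —
weak cosmic censorship to the late phase + a-priori bounds + orbital anchor + NON-DEGENERATE HORIZONS;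
FSC-implied through the settle disjunct, hence never too strong).** Tame-Christodoulou-generically in the
admissible class: an MGHD exists and every MGHD that does not settle (T2) carries a TAME ERA (closed-label
chart system C2–C11 of the crux's interface, `C⁰` anchor `1/8`, all-time `C^{k+4}` bounds, far-field
quarantine) each of whose hole charts has UNIFORMLY NON-DEGENERATE RED-SHIFT at its inner boundary:
`hᵢ⁻¹(drᵢ, drᵢ) ≥ κ₀ (rᵢ − r₊)` on a horizon collar at all late times (surface gravity bounded below —
the gauge-free form of "no extremal limit", the generic content behind `Literature.Barriers.
FinalStateConjecture.AretakisInstability`). Why it might fail short of the summit: generic developments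
with no precompact late-time translates in any era gauge, eternal bound `N`-body motion, generic
extremal LIMITS (κ → 0), persistent incoming far-field radiation (quarantine). Sources: Dafermos–Luk
arXiv:1710.01722 §1.2.1; Christodoulou CQG 16 (1999) A23; Aretakis arXiv:1206.6598. [cite: DafermosLuk2017] -/
theorem stub_genericTameEraRedShift : Sig.stub_genericTameEraRedShift := by
  sorry

/-- **STUB 2 `stub_redShiftExcludesExtremalRecurrence` (POINTWISE red-shift rigidity; L).** A maximal
development of admissible data carrying a tame era with uniformly non-degenerate red-shift at every hole's
inner boundary cannot recur, at any order `≥ 2` and in ANY anchored exhaustive closed-label chart system,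
to a configuration with an extremal hole `|aⱼ'| = Mⱼ'`: both systems cover the horizon collars (exhaustion
C10 + separation C7), the transition maps are uniformly bi-Lipschitz with bounded second derivatives
(both chart metrics non-degenerate up to the boundary, Kerr–Schild regular across `r = r₊`), both inner
boundaries are the event horizon, and `C²`-closeness to extremal Kerr–Schild forces
`h'⁻¹(dr', dr') ≤ C (r' − M')² + o(1)`, contradicting `hᵢ⁻¹(drᵢ, drᵢ) ≥ κ₀ (rᵢ − r₊)`. [folklore] -/
theorem stub_redShiftExcludesExtremalRecurrence : Sig.stub_redShiftExcludesExtremalRecurrence := by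
  sorry

/-! ### The registered stubs (the ONLY sorries of this file) -/

/-- **STUB 1 `stub_eraHorizonNull` (geometric, L).** In every tame era of a maximal development of
admissible data, the inner boundary `{rᵢ = r₊(Mᵢ, aᵢ)}` of each hole chart is the event horizon and is
NULL for the chart metric `hᵢ = Ψᵢ^* g` (extended by the era's bounds): the red-shift scalar
`hᵢ⁻¹(drᵢ, drᵢ)` tends to `0` uniformly at the inner boundary, at all late times. Mechanism: exhaustion
(C10) at every chart time forces the charts to cover all late points of `O`, separation (C7) and the flat
anchor exclude any other chart from a horizon collar, so `Ψᵢ` extends as an isometric immersion of the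
closed tube with boundary onto `H⁺ ∩ {late}`, an achronal hence null `C¹` hypersurface whose conormal is
`drᵢ`. [folklore] -/
theorem stub_eraHorizonNull : Sig.stub_eraHorizonNull := by
  sorry

/-- **STUB 2 `stub_asymptoticallyStationaryEra` (dynamics; research-grade, XL).** A tame era of a
NON-SETTLING maximal development of admissible data is ASYMPTOTICALLY STATIONARY in era gauge: the
`C^{k+2}` size of the Killing-translation derivative `∂_{Λᵢ∂₀}(Ψᵢ^* g − g_{Mᵢ,aᵢ,Λᵢ,cᵢ})` on every
truncated slab, and of `∂₀(Ψ₀^* g − η)` on the flat slabs, tends to `0`. Mechanism of record (line leads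
gens 5–6, all plumbing landed `--supports` the parent crux): a TRANSFER INEQUALITY paying the window
Killing-defect flux by Bondi-mass decrements (`…KillingDefectTransfer`), or Birkhoff uniform recurrence of
dark limits + ALMOST-PERIODIC RIGIDITY (`…UniformRecurrence`, `ReLineBirkhoff.AlmostPeriodicRigidity`);
Barbalat / Fatou forms landed (`…FluxFatou`, `…ScriBudget`). Nearest print: Alexakis–Schlue
arXiv:1504.04592 (time-periodic ⇒ stationary near 𝓘⁺), Bičák–Scholtz–Tod arXiv:1003.3402. [cite: AlexakisSchlue2018] -/
theorem stub_asymptoticallyStationaryEra : Sig.stub_asymptoticallyStationaryEra := by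
  sorry

/-- **STUB 3 `stub_noHairUpToGauge` (rigidity; research-grade, XL — black-hole uniqueness without
analyticity or smallness, UP TO GAUGE).** A `C^{k+3}` Lorentzian, Ricci-flat chart metric `G` on a
closed-label boosted Kerr exterior tube `{r > r₊(M,a)} × ℝ`, `1/4`-anchored to `g_{M,a,Λ,c}`, tame on
every `{r ≤ R'}`, invariant under the Killing translation `Λ∂₀`, and for which the inner boundary is a
null horizon (`G⁻¹(dr,dr) → 0`), is ISOMETRIC to a boosted Kerr–Schild exterior `g_{M',a',Λ',c'}` with a
closed label `|a'| ≤ M'` and the SAME asymptotic 4-velocity `Λ'∂₀ = Λ∂₀`, through a gauge `θ` commuting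
with the translations and mapping the new exterior ONTO the tube. Known only for `G` `C²`-close to Kerr
(Alexakis–Ionescu–Klainerman 2010) or real-analytic (Carter–Robinson, Hawking, Chruściel–Costa);
asymptotic flatness of stationary ends from boundedness: Reiris arXiv:1002.1172. [cite: arXiv:1002.1172] -/
theorem stub_noHairUpToGauge : Sig.stub_noHairUpToGauge := by
  sorry

/-- **STUB 4 `stub_rebase` (compactness + select-and-rebase + boundary layers; L).** Granted no-hair up to
gauge (stub 3 as a hypothesis): a tame era of a non-settling maximal development of admissible data whose
hole charts have null inner boundaries (stub 1) and which is asymptotically stationary (stub 2) RECURS at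
order `k + 2` with closed labels. Mechanism (landed toolkit of the parent crux, gens 3–6): `C^{k+3}_loc`
dark limits of the hole deviations exist jointly along some `Tₙ → ∞` (`…JointOmegaLimits`), inherit the
anchor, the bounds and the vacuum equations (`…OmegaLimitGlue/LimitBounds/VacuumOmegaLimits/LimitIsMetric`),
are stationary by asymptotic stationarity (`…AsymptoticStationarity`, converse direction), hence Kerr up
to gauge `θᵢ` with labels within the anchor slack; re-base the hole charts by `Ψᵢ ∘ θᵢ` (anchor
`1/8 + 1/8 ≤ 1/4`, `…LabelRebase/MotionRebase`), re-chart the far zone against the stationary far field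
(quarantine + flat anchor), transfer C2–C11 to the re-based system (same `O`), read recurrence at every
radius from `dark limit = reference` (`…ZeroLimitsConverge`, `…BackgroundOmegaLimits`) and close the
horizon boundary layer with the all-time `C^{k+3}` bounds along outward cones (`Birth.stub_holeCone` of
the parent line); orientation of `Λᵢ'V` at the recurrence instants from C11 + exhaustion. [folklore] -/
theorem stub_rebase : Sig.stub_rebase := by
  sorry

/-! ### Compositions -/

theorem GenericTameNonExtremalEra_of (hα : Sig.stub_genericTameEraRedShift)
    (hβ : Sig.stub_redShiftExcludesExtremalRecurrence) : Sig.GenericTameNonExtremalEra := by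
  intro k X _ _ _ _ _ _
  refine isTameChristodoulouGeneric_mono (hα k X) ?_
  rintro D hD ⟨hM, hP⟩
  refine ⟨hM, fun 𝒟 hmax hS ↦ ?_⟩
  obtain ⟨O, N, M, a, mo, τ₀, Ψ, ρ, R, U₀, Ψ₀, hera, hrs⟩ := hP 𝒟 hmax hS
  exact ⟨⟨O, N, M, a, mo, τ₀, Ψ, ρ, R, U₀, Ψ₀, hera⟩,
    hβ k X D hD 𝒟 hmax ⟨O, N, M, a, mo, τ₀, Ψ, ρ, R, U₀, Ψ₀, hera, hrs⟩⟩

theorem TameEraRecurs_of (hh : Sig.stub_eraHorizonNull) (h₁ : Sig.stub_asymptoticallyStationaryEra)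
    (h₀ : Sig.stub_noHairUpToGauge) (h₂ : Sig.stub_rebase) : Sig.TameEraRecurs := by
  intro k X _ _ _ _ _ _ D hD 𝒟 hmax hT hS
  obtain ⟨O, N, M, a, mo, τ₀, Ψ, ρ, R, U₀, Ψ₀, hera⟩ := hT
  exact h₂ k X D hD 𝒟 hmax hS (h₀ k) O N M a mo τ₀ Ψ ρ R U₀ Ψ₀ hera
    (hh k X D hD 𝒟 hmax O N M a mo τ₀ Ψ ρ R U₀ Ψ₀ hera) (h₁ k X D hD 𝒟 hmax hS O N M a mo τ₀ Ψ ρ R U₀ Ψ₀ hera)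

/-- **Assembly (BC2 redirect): child 1 → child 2 → the crux BY NAME.** Same proof as the evidence file
`ClusterCompletenessOmegaLimitMultiKerrSplit.lean` (`Theorems.omegaLimitMultiKerr_of_subs`). -/
theorem omegaLimitMultiKerr_of_subs (h₁ : Sig.GenericTameNonExtremalEra) (h₂ : Sig.TameEraRecurs) : OmegaLimitMultiKerr := by
  intro k X _ _ _ _ _ _
  refine isTameChristodoulouGeneric_mono (h₁ k X) ?_
  rintro D hD ⟨hM, hP⟩
  refine ⟨hM, fun 𝒟 hmax hS ↦ ?_⟩
  obtain ⟨hT, hN⟩ := hP 𝒟 hmax hS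
  obtain ⟨O, N, M, a, mo, τ₀, Ψ, ρ, R, U₀, Ψ₀, h1, h2, h3, h4, h5, h6, h7, h8, h9, h10, h11, h12, h13⟩ :=
    h₂ k X D hD 𝒟 hmax hT hS
  have hsub : ∀ i, Kerr.IsSubextremal (M i) (a i) :=
    hN O N M a mo τ₀ Ψ ρ R U₀ Ψ₀ ⟨h1, h2, h3, h4, h5, h6, h7, h8, h9, h10, h11, h12, h13⟩
  refine ⟨O, N, M, a, mo, τ₀, Ψ, ρ, R, U₀, Ψ₀, hsub, h2, h3, h4, h5, h6, h7, h8, h9, h10, h11, h12, ?_⟩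
  intro R' ε hε
  refine (h13 R' ε hε).mono fun τ hτ ↦ ⟨?_, fun i ↦ ⟨?_, (hτ.2 i).2⟩⟩
  · exact (𝒟.toSpacetime.deviationCk_mono (Minkowski.backgroundOn U₀) Ψ₀ (Nat.le_add_right k 2) τ).trans hτ.1
  · exact (supCkENorm_mono_right _ (Nat.le_add_right k 2) _).trans (hτ.2 i).1

/-- **The crux from the six stub signatures.** -/
theorem OmegaLimitMultiKerr_of (hα : Sig.stub_genericTameEraRedShift) (hβ : Sig.stub_redShiftExcludesExtremalRecurrence)
    (hh : Sig.stub_eraHorizonNull) (h₁ : Sig.stub_asymptoticallyStationaryEra) (h₀ : Sig.stub_noHairUpToGauge)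
    (h₂ : Sig.stub_rebase) : OmegaLimitMultiKerr :=
  omegaLimitMultiKerr_of_subs (GenericTameNonExtremalEra_of hα hβ) (TameEraRecurs_of hh h₁ h₀ h₂)

/-- … with the registered stubs plugged in. -/
theorem OmegaLimitMultiKerr_of_stubs : OmegaLimitMultiKerr :=
  OmegaLimitMultiKerr_of stub_genericTameEraRedShift stub_redShiftExcludesExtremalRecurrence stub_eraHorizonNull
    stub_asymptoticallyStationaryEra stub_noHairUpToGauge stub_rebase

end Summit.FinalStateConjecture.FinalStateConjecture.Cruxes.OmegaLimitMultiKerr.Split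

end
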